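import Summits.BirchSwinnertonDyer.BirchSwinnertonDyer.Theses.SemiOrdinaryEisensteinDescent
import Summits.BirchSwinnertonDyer.BirchSwinnertonDyer.Theorems.WildThreeRankOneBSDpOfExactIndexManin
import Summits.BirchSwinnertonDyer.BirchSwinnertonDyer.Theorems.SchneiderFreeAdditiveX3UpperReceptacle
import Summits.BirchSwinnertonDyer.BirchSwinnertonDyer.Theorems.ClassRecordThreeStepLOfHalvesB
import Summits.BirchSwinnertonDyer.BirchSwinnertonDyer.Theorems.UniversalToricDescentWildSplitWaldspurgerAtThreeFlat
import Summits.BirchSwinnertonDyer.Rank1Residual.X11b.UnrIntegersValuationRing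
import Summits.BirchSwinnertonDyer.Rank1Residual.X11b.PadicComplexInertiaFixed
import Literature.NumberTheory.EllipticCurves.BSDHeegnerPointsGrossZagierProofs
import Literature.NumberTheory.EllipticCurves.KrizLi2019.SexticTwistBSDThreeDescent
import Literature.NumberTheory.EllipticCurves.GlobalMinimalModelProofs
import Literature.NumberTheory.EllipticCurves.ModularCurveManinConstantProofs
import HarnessLib

/-!
# Route `SemiOrdinaryEisensteinDescent`: the RESTRICTED KERNEL re-keyed at crux #4 — the Waldspurger crux
# `WildSplitWaldspurgerAtThree` (V, stmt-BirchSwinnertonDyer-20385) REPLACED by {an `R₀`-valued BDP FRAME at the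
# Friedberg–Hoffstein field (odd `d_K`) = item 20928's text + `Odd (discr K)`} + {the refereed Liu–Zhang–Zhang input
# (20316) BY NAME}; the unit value `u ∈ R₀ˣ` is FORCED at the kernel's frame (cell `pub/bsd-wall`, width seat
# `bsd-wall-soed-p1-w3` g6, `--supports stmt-BirchSwinnertonDyer-24155`, helper; BSD is not proved by any of this)

WHY. The route pen's PLAN (B) (bsd-wall STATUS 2026-08-28T01:37:13Z) moves crux #4 out of the open-crux cone of route
`UniversalToricDescent` by reading it at ODD `d_K` only — where it is «print + one mechanical port» (Hsieh 2014 Thm A at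
any level + BDP13's value reciprocity) — and announces «SOED #4 later, same move». On the SOED side the move is THIS
file: the restricted kernel `WildSplitEisensteinInclusionAtThreeRankOneRestriction.wAllExclAddWildRankOneSurj_of_restricted`
(p588074 §3, closing shape of item `EisensteinKernelAtThreeRestricted` 24156) calls `hV : WildSplitWaldspurgerAtThree`
exactly ONCE (its l.285–286), AFTER it has derived `Odd (NumberField.discr K)` for its Friedberg–Hoffstein field (l.257,
`2` split). So the kernel needs from crux #4 only:
* a FRAME `∃ ι′ ⊳ 𝔭, ∃ (Ω_K ≠ 0, Ω_p ≠ 0, L ∈ R₀⟦T⟧), IsBDPLFunction ι′ 𝔭 κ γ Dt.f Ω_K Ω_p L` at that field — the text of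
  UTD's child item 20928 `WildSplitFrameAtThree` with the single binder `Odd (NumberField.discr K)` inserted after the
  Heegner hypothesis (displayed below as the hypothesis `hFr`; = the pen's `WildSplitFrameAtThreeOdd`, Sketch-utd-idea-g13
  S♯), and
* the VALUE `L(𝟙) = u·(log_{ω_E} P / c)²`, `u ∈ R₀ˣ`, which is AUTOMATIC on every frame from the refereed Liu–Zhang–Zhang
  input `LiuZhangZhang2018.thm151_thm153_modularCurve_heegnerVector_additive` (item 20316) by kmc g19's glue argument
  (p541741 `UniversalToricDescentWaldspurgerFlat.wildSplitWaldspurgerAtThree_of_lzz_of_frame`): ♭-rigidity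
  `wildSplitWaldspurgerAtThree_flat_forall` pins `[T⁰]L = u₀·(log_ω P/c)²` with `‖u₀‖ = 1`, and `R₀` is a valuation
  ring, so `u₀ ∈ R₀ˣ` — made POINTWISE here (§1), which the glue states only `∀ ↦ ∀`.

CONTENTS (0 definitions, 0 named facts, 0 `sorry`; every crux / published input is an ANTECEDENT):
* §1 `exists_unit_hasValueAt_of_frame` — the POINTWISE value clause of crux #4: LZZ input + ONE frame at
  `(W, K, Dt, H, ι, P = y_K non-torsion, κ, γ, 𝔭, ι′)` ⟹ `∃ u : R₀ˣ, L(𝟙) = u·(log_{ω,𝔭} P / c)²` (any parity of `d_K`).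
* §2 `wAllExclAddWildRankOneSurj_of_restricted_of_frameOdd` — THE RE-KEYED RESTRICTED KERNEL:
  `PublishedInputsWildThree → WildSplitEisensteinInclusionAtThreeRestricted (crux #2′, 24155, BY NAME) →
  WildKolyvaginUpperAtThree → LZZ → [frame at odd d_K] → WildSplitControlAtThree → WildRankZeroTwistAtThree →
  WildRankOneSurjNonTowerAtThree → WAllExclAddWildRankOneSurj` — bed-p3 g1's kernel proof
  (`semiOrdinaryEisensteinDescent_eisensteinKernelAtThree_proof`) / p588074 §3 VERBATIM except step (b), where `hV` is
  replaced by `hFr` + §1, and the Eisenstein step, fed by `E′` at the Friedberg–Hoffstein field where its extra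
  binders `(H, ι, P)`, `L(E^{(d_K)},1) ≠ 0`, `P = y_K`, `¬ IsOfFinAddOrder P` are in hand. This is the closing shape
  of the pen's coming SOED item «kernel′ of frame-odd» (whatever its packaging of {LZZ, frame-odd}, the closer is
  one `exact` / one `fun`).
* §3 corollary `…_of_frame`: the frame supplied at every parity (= item 20928's text VERBATIM, displayed) — V BY
  NAME is not needed anywhere on the SOED side once {LZZ, a frame at the kernel's field} are granted.
Imports are route-independent apart from the route file itself (theses-cone clean).

HONEST STATUS. Bookkeeping only: crux #4's research content at odd `d_K` (the frame) and the Eisenstein crux `E′`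
(walls W1–W3 of the leads' census) are untouched antecedents; the named-fact exposure of SOED's kernel at #4 drops from
{V whole, every Heegner K} to {frame at the kernel's own field} + one refereed input. BSD₃ is proved for no curve.

References: [JetchevSkinnerWan2017] §7.4.1 (arXiv:1512.06894 p. 30); [LiuZhangZhang2018] Duke Math. J. 167 (2018)
Thm 1.5.1, Thm 1.5.3; [Castella2018] Thm. 2.3, Thm. 3.1–3.2, §5; [GrossZagier1986] Thm. I.(6.3);
[FriedbergHoffstein1995] Thm. B; [SerreLocalFields1979] Ch. II §5, Ch. IV §4 (the valuation ring `R₀` and its units).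
-/

noncomputable section

open scoped Classical NumberField

set_option linter.dupNamespace false -- `Summit.BirchSwinnertonDyer.BirchSwinnertonDyer.Theorems.…` (summit = sub, D-0017)
set_option autoImplicit false

namespace Summit.BirchSwinnertonDyer.BirchSwinnertonDyer.Theorems.EisensteinKernelAtThreeRestrictedOfFrameOdd

open WeierstrassCurve NumberField IsDedekindDomain Field PowerSeries
  Literature.NumberTheory.EllipticCurves
  Literature.NumberTheory.EllipticCurves.ModularForms
  Literature.NumberTheory.EllipticCurves.LiuZhangZhang2018
  Literature.NumberTheory.EllipticCurves.Rank1Residual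
  Literature.NumberTheory.EllipticCurves.KrizLi2019
  Summit.BirchSwinnertonDyer.Rank1Residual
  Summit.BirchSwinnertonDyer.Rank1Residual.Additive
  Summit.BirchSwinnertonDyer.Rank1Residual.X11b
  Summit.BirchSwinnertonDyer.Rank1Residual.X11b.AcSelmer
  Summit.BirchSwinnertonDyer.Rank1Residual.X11b.Halves
  Summit.BirchSwinnertonDyer.BirchSwinnertonDyer.Theses.SemiOrdinaryEisensteinDescent
  Summit.BirchSwinnertonDyer.BirchSwinnertonDyer.Theorems

/-! ### §1 The value clause of crux #4 is forced on every single frame (pointwise form of the OfFrame glue) -/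

/-- **Pointwise value of a BDP frame at the wild split `3`.** For `W` on the wild class (`ClassO6 W 3`) of conductor
`N`, `K` imaginary quadratic Heegner for `N`, the datum `(Dt, H, ι)`, `P ∈ E(K)` mapping to the Heegner point and of
infinite order, an anticyclotomic frame `(κ, γ)`, a degree-one prime `𝔭 ∋ 3`, an embedding datum `ι′` inducing `𝔭`,
and ONE `R₀`-valued frame `(Ω_K ≠ 0, Ω_p ≠ 0, L)` with Castella's interpolation property `IsBDPLFunction`: granted the
refereed Liu–Zhang–Zhang input, `L(𝟙) = u·(log_{ω_E,𝔭} P / c)²` for some UNIT `u ∈ R₀ˣ`. Proof = kmc g19's glue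
(p541741) read at one frame: ♭-rigidity `wildSplitWaldspurgerAtThree_flat_forall` gives the value with a norm-one
constant `u₀ ∈ ℂ₃`; `u₀ = [T⁰]L / (log_ω P/c)² ∈ Frac R₀` has norm one, so lies in the valuation ring `R₀` and is a unit.
CONDITIONAL on `hL`; no parity hypothesis on `d_K`.
[cite: LiuZhangZhang2018, Thm 1.5.1 and Thm 1.5.3 (Duke Math. J. 167 pp. 748–749)]
[cite: SerreLocalFields1979, Ch. II §5 and Ch. IV §4, Prop. 16] -/
theorem exists_unit_hasValueAt_of_frame (hL : thm151_thm153_modularCurve_heegnerVector_additive)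
    (W : WeierstrassCurve ℚ) [W.IsElliptic] [W.IsGloballyMinimal] (N : ℕ) [NeZero N] (K : Type) [Field K]
    [NumberField K] (Dt : ModularParametrizationData W N) (H : HeegnerDatum N (NumberField.discr K))
    (ι : K →+* ℂ) (P : (W.baseChange K).toAffine.Point)
    (hO6 : ClassO6 W 3) (hN : W.conductorNorm ℤ = N) (hK : IsImaginaryQuadratic K)
    (hHN : SatisfiesHeegnerHypothesis N K)
    (hP : WeierstrassCurve.Affine.Point.map ι.toRatAlgHom P = heegnerPointComplex Dt H) (hPinf : ¬ IsOfFinAddOrder P)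
    (κ : ZpExtension K 3) (hκ : κ.IsAnticyclotomic) (γ : Field.absoluteGaloisGroup K) [Fact (κ.IsTopGenerator γ)]
    (𝔭 : HeightOneSpectrum (𝓞 K)) (h𝔭 : ((3 : ℕ) : 𝓞 K) ∈ 𝔭.asIdeal) (he : 𝔭.asIdeal.ramificationIdx (𝓞 ℚ) = 1)
    (hf : 𝔭.asIdeal.inertiaDeg (𝓞 ℚ) = 1) (ι' : PadicAlgCl 3 ≃+* ℂ) (hι' : SchneiderFree.BranchInducesPrime 3 ι' 𝔭)
    {ΩK : ℂ} {Ωp : ℂ_[3]} {L : UnrSeries 3} (hΩK : ΩK ≠ 0) (hΩp : Ωp ≠ 0)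
    (hLfr : IsBDPLFunction ι' 𝔭 κ γ Dt.f ΩK Ωp L) :
    ∃ u : (unrIntegers 3)ˣ, L.HasValueAt 0 ((((u : unrIntegers 3) : unrIntegers 3) : ℂ_[3]) *
      (algebraMap ℚ_[3] ℂ_[3] (logOmega W 3 (embAt K 3 𝔭 h𝔭 he hf) P / (Dt.c : ℚ_[3]))) ^ 2) := by
  -- the frame read in `𝓞_{ℂ₃}⟦T⟧` and its value at `𝟙` (♭-rigidity, LZZ input)
  have hQ' : R1.IsBDPLFunctionInt 3 ι' 𝔭 κ γ Dt.f ΩK Ωp (PowerSeries.map (R1.unrToCpInt 3) L) :=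
    R1.isBDPLFunctionInt_map hLfr
  obtain ⟨u₀, hu₀, hv⟩ := UniversalToricDescentWaldspurgerFlat.wildSplitWaldspurgerAtThree_flat_forall hL W N K Dt
    H ι P hO6 hN hK hHN hP hPinf κ hκ γ 𝔭 h𝔭 he hf ι' hι' hΩK hΩp hQ'
  set x : ℚ_[3] := logOmega W 3 (embAt K 3 𝔭 h𝔭 he hf) P / (Dt.c : ℚ_[3]) with hx
  have hv' : L.HasValueAt 0 (u₀ * (algebraMap ℚ_[3] ℂ_[3] x) ^ 2) :=
    (R1.intSeries_hasValueAt_map_iff 3 L _ _).mp hv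
  have hcoef : ((PowerSeries.constantCoeff L : unrIntegers 3) : ℂ_[3]) = u₀ * (algebraMap ℚ_[3] ℂ_[3] x) ^ 2 :=
    (UnrSeries.eq_constantCoeff_of_hasValueAt_zero hv').symm
  -- `x ≠ 0`: `P` of infinite order, `c ≠ 0`
  have hlogne : logOmega W 3 (embAt K 3 𝔭 h𝔭 he hf) P ≠ 0 := R1.logOmega_ne_zero W 3 _ hPinf
  have hcZ : Dt.c ≠ 0 := Dt.maninConstant_ne_zero_holds
  have hx0 : x ≠ 0 := div_ne_zero hlogne (by exact_mod_cast hcZ)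
  have hx2 : x ^ 2 ≠ 0 := pow_ne_zero _ hx0
  -- the quotient `[T⁰]L / x²` has norm one, lies in `Frac R₀`, hence in `R₀`, hence is a unit
  set y : ℂ_[3] := algebraMap ℚ_[3] ℂ_[3] (x ^ 2) with hy
  have hy0 : y ≠ 0 := (map_ne_zero_iff _ (algebraMap ℚ_[3] ℂ_[3]).injective).mpr hx2
  have hnorm : ‖((PowerSeries.constantCoeff L : unrIntegers 3) : ℂ_[3])‖ = ‖y‖ := by
    rw [hcoef, norm_mul, hu₀, one_mul, hy, map_pow]
  have hyF : y ∈ Subfield.closure (unrIntegers 3 : Set ℂ_[3]) := by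
    rw [hy, IsScalarTower.algebraMap_apply ℚ_[3] (PadicAlgCl 3) ℂ_[3] (x ^ 2)]
    exact PadicComplexTransport.algebraMap_padic_mem_fracUnr 3 (x ^ 2)
  set c₀ : ℂ_[3] := ((PowerSeries.constantCoeff L : unrIntegers 3) : ℂ_[3]) with hc₀
  have hw : c₀ / y ∈ Subfield.closure (unrIntegers 3 : Set ℂ_[3]) :=
    div_mem (Subfield.subset_closure (PowerSeries.constantCoeff L).2) hyF
  have hw1 : ‖c₀ / y‖ = 1 := by
    rw [norm_div, hc₀, hnorm, div_self (norm_ne_zero_iff.mpr hy0)]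
  have hwR : c₀ / y ∈ unrIntegers 3 := R1.mem_unrIntegers_of_mem_fracUnr hw hw1.le
  obtain ⟨u, hu⟩ := (unrIntegers.isUnit_iff_norm_eq_one ⟨c₀ / y, hwR⟩).mpr hw1
  refine ⟨u, ?_⟩
  have hval : ((u : unrIntegers 3) : ℂ_[3]) * (algebraMap ℚ_[3] ℂ_[3] x) ^ 2 = c₀ := by
    rw [hu, ← map_pow, ← hy]
    exact div_mul_cancel₀ c₀ hy0
  have h0 := L.hasValueAt_zero
  rw [← hc₀, ← hval] at h0
  exact h0

/-! ### §2 The restricted kernel with crux #4 fed by {LZZ, a frame at the Friedberg–Hoffstein field} -/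

/-- **THE RE-KEYED RESTRICTED KERNEL.** `PublishedInputsWildThree → WildSplitEisensteinInclusionAtThreeRestricted
(crux #2′, stmt-BirchSwinnertonDyer-24155, BY NAME) → WildKolyvaginUpperAtThree → LZZ (item 20316's fact BY NAME) →
[R₀-valued BDP frame at ODD d_K: item 20928's text + Odd (discr K), displayed as hFr] → WildSplitControlAtThree →
WildRankZeroTwistAtThree → WildRankOneSurjNonTowerAtThree → WAllExclAddWildRankOneSurj`. Proof: the route kernel
(bed-p3 g1 `semiOrdinaryEisensteinDescent_eisensteinKernelAtThree_proof`; p588074 §3 for `E′`) VERBATIM — tower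
split; Friedberg–Hoffstein with modulus `2`, so `d_K ≡ 1 (mod 8)` is ODD; Heegner point; Gross–Zagier; Kolyvagin;
frame `(κ, γ, 𝔭, 𝔭′)`; control at `𝔭′` (torsion guard); Eisenstein inclusion `⊆` at the frame ⟹ lower socket
(`Supersingular.two_mul_valuation_le_of_mem_span`); Kolyvagin crux ⟹ upper socket; p528981 — except that step (b)
takes the frame from `hFr` at the kernel's own field and the unit value `u ∈ R₀ˣ` from §1 instead of from crux #4
`WildSplitWaldspurgerAtThree`, which is NOT an antecedent any more. Every remaining crux / input is an antecedent;
BSD is not proved by this.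
[cite: JetchevSkinnerWan2017, §7.4.1 (arXiv:1512.06894 p. 30)] [cite: Castella2018, Thm. 2.3 and §5 (5.1)–(5.3)]
[cite: LiuZhangZhang2018, Thm 1.5.1 and Thm 1.5.3] [cite: GrossZagier1986, Thm. I.(6.3) and V.§2]
[cite: FriedbergHoffstein1995, Thm. B] -/
theorem wAllExclAddWildRankOneSurj_of_restricted_of_frameOdd (hF : PublishedInputsWildThree)
    (hE' : WildSplitEisensteinInclusionAtThreeRestricted)
    (hKoly : WildKolyvaginUpperAtThree) (hLZZ : thm151_thm153_modularCurve_heegnerVector_additive)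
    (hFr : ∀ (W : WeierstrassCurve ℚ) [W.IsElliptic] [W.IsGloballyMinimal] (N : ℕ) [NeZero N] (K : Type) [Field K] [NumberField K] (Dt : Literature.NumberTheory.EllipticCurves.ModularForms.ModularParametrizationData W N), Summit.BirchSwinnertonDyer.Rank1Residual.Additive.ClassO6 W 3 → W.conductorNorm ℤ = N → Literature.NumberTheory.EllipticCurves.IsImaginaryQuadratic K → Literature.NumberTheory.EllipticCurves.SatisfiesHeegnerHypothesis N K → Odd (NumberField.discr K) → ∀ (κ : Literature.NumberTheory.EllipticCurves.ZpExtension K 3), κ.IsAnticyclotomic → ∀ (γ : Field.absoluteGaloisGroup K) [Fact (κ.IsTopGenerator γ)] (𝔭 : IsDedekindDomain.HeightOneSpectrum (NumberField.RingOfIntegers K)), ((3 : ℕ) : NumberField.RingOfIntegers K) ∈ 𝔭.asIdeal → ∃ ι' : PadicAlgCl 3 ≃+* ℂ, Summit.BirchSwinnertonDyer.BirchSwinnertonDyer.Theorems.SchneiderFree.BranchInducesPrime 3 ι' 𝔭 ∧ ∃ (ΩK : ℂ) (Ωp : ℂ_[3]) (L : Literature.NumberTheory.EllipticCurves.UnrSeries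 3), ΩK ≠ 0 ∧ Ωp ≠ 0 ∧ Literature.NumberTheory.EllipticCurves.IsBDPLFunction ι' 𝔭 κ γ Dt.f ΩK Ωp L)
    (hC : WildSplitControlAtThree) (hZ : WildRankZeroTwistAtThree) (hNT : WildRankOneSurjNonTowerAtThree) :
    Summit.BirchSwinnertonDyer.WAllExclAddWildRankOneSurj := by
  unfold Summit.BirchSwinnertonDyer.WAllExclAddWildRankOneSurj
  intro W _ _ hncm hO6 hsurj hr
  -- (o) TOWER SPLIT: off the tower-surjective rows the residual crux pays by name
  by_cases htower : AdditiveThree.TowerSurjThree W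
  swap
  · exact hNT W hncm hO6 hsurj htower hr
  obtain ⟨hGZ, hKo, hGZK, hmod, hmodP, -, hGZ73, hFH, hpar, hHP⟩ := hF
  haveI hN0 : NeZero (W.conductorNorm ℤ) := ⟨W.conductorNorm_pos_holds.ne'⟩
  -- (a) DATA. parity: `r_an = 1` is odd, so `w(E) = -1`
  have hw : W.rootNumber = -1 := by
    rcases W.rootNumber_eq_one_or with h | h
    · exfalso
      have heven : Even W.analyticRank := (hpar W).mpr h
      rw [hr] at heven
      exact Nat.not_even_one heven
    · exact h
  -- Friedberg–Hoffstein with auxiliary modulus `2`: Heegner for `N(E)`, `2` split, `L(E^{(d_K)},1) ≠ 0`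
  obtain ⟨K, _, _, hK, -, hHN, hH2, hLt⟩ := hFH W hw 2 two_ne_zero 0
  have hodd : Odd (NumberField.discr K) := by
    have h8 := Literature.SatisfiesHeegnerHypothesis.discr_emod_eight hK.1 hH2 (dvd_refl 2)
    rw [Int.odd_iff]; omega
  -- `3 ∣ N(E)` (additive) splits in `K`; hence `d_K ≠ -3`
  have h3N : 3 ∣ W.conductorNorm ℤ :=
    (W.dvd_conductorNorm_iff_not_hasGoodReductionAtPrime 3).mpr (not_good_of_addv W 3 hO6.2.1)
  have hsplit : SplitsIn K 3 := hHN 3 Nat.prime_three h3N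
  have hd3 : NumberField.discr K ≠ -3 := by
    intro h
    exact Literature.SatisfiesHeegnerHypothesis.not_dvd_discr hK.1 hHN Nat.prime_three h3N
      (by rw [h]; norm_num)
  -- the Heegner point over `K` and its datum; non-torsion by Gross–Zagier
  obtain ⟨P, Dt, H, ι, hP⟩ := hHP W K hK hHN
  have hL0 : W.entireLFunction 1 = 0 := entireLFunction_one_eq_zero_of_analyticRank_eq_one hr
  obtain ⟨-, hderiv⟩ := leadingLCoeff_eq_deriv_of_analyticRank_eq_one hr
  have hLK : LDerivEK W K ≠ 0 := by
    rw [lDerivEK_eq_deriv_mul W K hmod hL0]; exact mul_ne_zero hderiv hLt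
  have hnt : ¬ IsOfFinAddOrder P :=
    (lDerivEK_ne_zero_iff_not_isOfFinAddOrder W (W.conductorNorm ℤ) K (hGZ _ W K) hK hHN
      ⟨Dt, H, ι, hP⟩).mp hLK
  -- Kolyvagin: `rank E(K) = 1`, `Ш(E/K)` finite
  obtain ⟨hrk, hfin⟩ := hKo (W.conductorNorm ℤ) W K hK hHN ⟨Dt, H, ι, hP⟩ hnt
  -- a frame `(κ, γ, 𝔭)` and the other prime `𝔭′ ≠ 𝔭` above `3`
  obtain ⟨κ, γ, -, hκ, hγ, -⟩ := X11b.exists_anticyclotomic_generator_prime (p := 3) hK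
  haveI : Fact (κ.IsTopGenerator γ) := ⟨hγ⟩
  obtain ⟨𝔭, h𝔭, he, hf⟩ := X11b.exists_degreeOnePrime_of_splitsIn K 3 hK.1 hsplit
  obtain ⟨𝔭', hne, h𝔭', he', hf'⟩ := X11b.Three.exists_ne_degreeOne_prime hK.1 h𝔭 he hf
  -- (b) PLUMBING. the BDP frame at `(κ, γ, 𝔭)` over the Friedberg–Hoffstein field (odd `d_K`) — item 20928's text
  -- at odd `d_K` — and its unit value, FORCED by the LZZ input (§1); this is the one place the old kernel used `hV`
  obtain ⟨ι', hind, ΩK, Ωp, L, hΩK, hΩp, hBDP⟩ :=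
    hFr W (W.conductorNorm ℤ) K Dt hO6 rfl hK hHN hodd κ hκ γ 𝔭 h𝔭
  obtain ⟨u, hval⟩ := exists_unit_hasValueAt_of_frame hLZZ W (W.conductorNorm ℤ) K Dt H ι P hO6 rfl hK hHN hP hnt
    κ hκ γ 𝔭 h𝔭 he hf ι' hind hΩK hΩp hBDP
  -- control count at `𝔭′` (CTL₀ included; supplies the torsion guard of the Eisenstein residual)
  have hctl : SchneiderFree.AdditiveControlOnTreeAt 3 κ 𝔭' γ (embAt K 3 𝔭' h𝔭' he' hf') P :=
    hC W (W.conductorNorm ℤ) K Dt H ι P hO6 hsurj hr rfl hK hHN hLt hP hnt (hKo _ W K) κ hκ γ 𝔭'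
      h𝔭' he' hf'
  obtain ⟨n, hn, hneq⟩ := hctl
  -- the value read through the logarithm at `𝔭′` (rank one: `(log_{𝔭′} P)² = (log_𝔭 P)²`)
  have hval' : L.HasValueAt 0 ((((u : unrIntegers 3) : unrIntegers 3) : ℂ_[3]) *
      (algebraMap ℚ_[3] ℂ_[3]
        (logOmega W 3 (embAt K 3 𝔭' h𝔭' he' hf') P / (Dt.c : ℚ_[3]))) ^ 2) :=
    (SchneiderFreeAdditiveX3.hasValueAt_sq_logOmega_embAt_iff_of_rank_one W 3 hK.1 hrk h𝔭 he hf
      h𝔭' he' hf' P _ _ L).mpr hval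
  -- the LOWER socket at slack `v₃(c)` at the frame `(κ, 𝔭′, γ, embAt 𝔭′)` — from crux #2′
  have hc0 : Dt.c ≠ 0 := Dt.maninConstant_ne_zero_holds
  have hlog : logOmega W 3 (embAt K 3 𝔭' h𝔭' he' hf') P ≠ 0 := X11b.R1.logOmega_ne_zero W 3 _ hnt
  have hlow : SchneiderFree.AdditiveIMCLowerBDPOnTreeLeAt 3 κ 𝔭' γ (embAt K 3 𝔭' h𝔭' he' hf')
      (padicValNat 3 Dt.c.natAbs) P := by
    obtain ⟨htors, f, hfI, hf0, hfn⟩ := hn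
    -- the RESTRICTED EISENSTEIN INCLUSION `Ch_Λ(X_(∅,0))·R₀⟦T⟧ ⊆ (L)` at the frame (crux #2′ by name, torsion-guarded),
    -- fed WITH the datum the kernel holds here (`H, ι, P`, `L(E^{(d_K)},1) ≠ 0`, `P = y_K`, `P` non-torsion)
    have hincl : (XAc.charIdeal (W.baseChange K) 3 κ 𝔭' ∅ γ).map (PowerSeries.map (toUnr 3)) ≤ Ideal.span {L} :=
      hE' W (W.conductorNorm ℤ) K Dt H ι P hO6 hsurj hr rfl hK hHN hLt hP hnt κ hκ γ 𝔭 h𝔭 he hf 𝔭' h𝔭' hne ι' hind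
        ΩK Ωp L hΩK hΩp hBDP htors
    have hmem : PowerSeries.map (toUnr 3) f ∈ Ideal.span {L} := by
      rw [hfI, CongruenceLimit.map_span_singleton_powerSeries] at hincl
      exact (Ideal.span_singleton_le_iff_mem _).mp hincl
    obtain ⟨-, hle⟩ := Supersingular.two_mul_valuation_le_of_mem_span 3 hf0 hmem u hval'
    have hc0' : (Dt.c : ℚ_[3]) ≠ 0 := by exact_mod_cast hc0
    rw [div_eq_mul_inv, Padic.valuation_mul hlog (inv_ne_zero hc0'), Padic.valuation_inv,
      Padic.valuation_intCast, valuation_logOmega hlog, hfn] at hle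
    refine ⟨n, ⟨htors, f, hfI, hf0, hfn⟩, ?_⟩
    simp only [padicValInt] at hle
    linarith
  have hlo : SchneiderFree.IndexLowerBoundLeAt W 3 K P (padicValNat 3 Dt.c.natAbs) :=
    SchneiderFreeAdditiveX3.indexLowerBoundLeAt_of_imcLowerLe_of_control rfl hK hHN hfin hlow
      ⟨n, hn, hneq⟩
  -- the UPPER socket at slack `v₃(c)` IS the Kolyvagin crux (tower surjectivity, `d_K` odd, `≠ -3`)
  have hupI : SchneiderFree.Upper.IndexUpperBoundLeAt W 3 K P (padicValNat 3 Dt.c.natAbs) :=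
    hKoly W (W.conductorNorm ℤ) K Dt H ι P hO6 hsurj hr rfl hK hHN hLt hP hnt hodd hd3 htower
  -- (c) TERMINAL STEP: a globally minimal model of the twist, then p528981
  have hD0 : (NumberField.discr K : ℚ) ≠ 0 := by exact_mod_cast NumberField.discr_ne_zero K
  haveI : (W.quadraticTwist (NumberField.discr K : ℚ)).IsElliptic := W.isElliptic_quadraticTwist hD0
  obtain ⟨Cd, hCd⟩ := hasGlobalMinimalModel_rat_holds (W.quadraticTwist (NumberField.discr K : ℚ))
  haveI : (Cd • W.quadraticTwist (NumberField.discr K : ℚ)).IsGloballyMinimal := hCd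
  exact SchneiderFree.Exact.bsdp_three_of_exactIndexManin_of_wAllExclAddWildRankZero hGZ hKo hGZK hmod
    hGZ73 hZ W hO6 hsurj hr (W.conductorNorm ℤ) K Dt H ι P
    (Cd • W.quadraticTwist (NumberField.discr K : ℚ)) rfl hK hodd hHN hLt hP ⟨Cd, rfl⟩ hlo hupI

/-! ### §3 Corollary: the frame granted at every parity (item 20928's text verbatim) -/

/-- **The re-keyed kernel with the frame granted at EVERY Heegner field** (`hFr₀` = the text of UTD's item 20928
`WildSplitFrameAtThree` VERBATIM, displayed; the parity binder is simply not used). [folklore] -/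
theorem wAllExclAddWildRankOneSurj_of_restricted_of_frame (hF : PublishedInputsWildThree)
    (hE' : WildSplitEisensteinInclusionAtThreeRestricted) (hKoly : WildKolyvaginUpperAtThree)
    (hLZZ : thm151_thm153_modularCurve_heegnerVector_additive)
    (hFr₀ : ∀ (W : WeierstrassCurve ℚ) [W.IsElliptic] [W.IsGloballyMinimal] (N : ℕ) [NeZero N] (K : Type) [Field K] [NumberField K] (Dt : Literature.NumberTheory.EllipticCurves.ModularForms.ModularParametrizationData W N), Summit.BirchSwinnertonDyer.Rank1Residual.Additive.ClassO6 W 3 → W.conductorNorm ℤ = N → Literature.NumberTheory.EllipticCurves.IsImaginaryQuadratic K → Literature.NumberTheory.EllipticCurves.SatisfiesHeegnerHypothesis N K → ∀ (κ : Literature.NumberTheory.EllipticCurves.ZpExtension K 3), κ.IsAnticyclotomic → ∀ (γ : Field.absoluteGaloisGroup K) [Fact (κ.IsTopGenerator γ)] (𝔭 : IsDedekindDomain.HeightOneSpectrum (NumberField.RingOfIntegers K)), ((3 : ℕ) : NumberField.RingOfIntegers K) ∈ 𝔭.asIdeal → ∃ ι' : PadicAlgCl 3 ≃+* ℂ, Summit.BirchSwinnertonDyer.BirchSwinnertonDyer.Theorems.SchneiderFree.BranchInducesPrime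 3 ι' 𝔭 ∧ ∃ (ΩK : ℂ) (Ωp : ℂ_[3]) (L : Literature.NumberTheory.EllipticCurves.UnrSeries 3), ΩK ≠ 0 ∧ Ωp ≠ 0 ∧ Literature.NumberTheory.EllipticCurves.IsBDPLFunction ι' 𝔭 κ γ Dt.f ΩK Ωp L)
    (hC : WildSplitControlAtThree) (hZ : WildRankZeroTwistAtThree) (hNT : WildRankOneSurjNonTowerAtThree) :
    Summit.BirchSwinnertonDyer.WAllExclAddWildRankOneSurj :=
  wAllExclAddWildRankOneSurj_of_restricted_of_frameOdd hF hE' hKoly hLZZ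
    (fun W _ _ N _ K _ _ Dt hO6 hN hK hH _ κ hκ γ _ 𝔭 h𝔭 ↦ hFr₀ W N K Dt hO6 hN hK hH κ hκ γ 𝔭 h𝔭) hC hZ hNT

end Summit.BirchSwinnertonDyer.BirchSwinnertonDyer.Theorems.EisensteinKernelAtThreeRestrictedOfFrameOdd

end
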